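import Summits.AtomisticToContinuum.FouriersLaw.Theses.BondHeatUncertainty
import Literature.MathematicalPhysics.KineticTheory.LangevinChainReversal
import Literature.Probability.Entropy.FluctuationTheoremUncertainty
import Summits.AtomisticToContinuum.FouriersLaw.Theorems.BondHeatUncertaintyDefs
import Summits.AtomisticToContinuum.FouriersLaw.Theorems.BondHeatUncertaintyLinearResponseFTURSteadyHeatRatesHelper4
import Summits.AtomisticToContinuum.FouriersLaw.Theorems.BondHeatUncertaintyLinearResponseFTURSteadyHeatRatesHelper5
import Literature.MathematicalPhysics.KineticTheory.LangevinChainTheorem51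

/-!
# Stub `stub_steadyHeatRates` of line `lebesgue-flip-duality` (crux ★ `LinearResponseFTUR`, stmt-AtomisticToContinuum-9122) — steady heat rates

Target: `Summits/AtomisticToContinuum/FouriersLaw/Theorems/BondHeatUncertaintyLinearResponseFTURSteadyHeatRates.lean`
(`ledger propose --supports stmt-AtomisticToContinuum-9122`). The theorem name and signature text below are REGISTERED on
the item — do not change a character of the statement.

Proof (helpers 1–5, `…LinearResponseFTURSteadyHeatRatesHelper{1,…,5}.lean`): under weak-NESS uniqueness the steady
state `μ` IS the Krylov–Bogoliubov invariant probability measure of the constructed transition semigroup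
(`pinnedChainSemigroup_exists_isInvariant_of_pos` + `pinnedChain_isSteadyState_of_isInvariant`), hence invariant for the
constructed kernels and with all polynomial energy moments (helper 1). Weak stationarity extends to polynomially bounded
observables (helper 2) and, tested on `p_i²/2`, `U(q_i)`, `V(q_{i+1} - q_i)` (helper 3), makes all steady bond currents
equal to `W_0 = ⟨p_0 ∂_{q_0}H⟩_μ`, the total current `(N-1) W_0` and `⟨p_{N-1} ∂_{q_{N-1}}H⟩_μ = -W_0` (helper 4). Along
the stationary flow the one-time laws are `μ` and time integrals have mean `t ∫ · dμ` (helper 5), so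
`E[Q_L] = E[p_0(t)²/2] - E[p_0(0)²/2] + t W_0 = t J`, `E[Q_R] = -t J`, `E[Q^b] = t J`, `J = totalCurrent/(N-1) = W_0`.
-/

noncomputable section

namespace Summit.AtomisticToContinuum.FouriersLaw.Theorems.LinearResponseFTUR

open MeasureTheory ProbabilityTheory Filter Topology Set
open scoped NNReal ENNReal
open Literature.MathematicalPhysics.KineticTheory
open Literature.MathematicalPhysics.KineticTheory.HeatConduction
open Literature.Probability.Process
open Summit.AtomisticToContinuum.FouriersLaw.Theorems.BondHeatUncertainty
open Summit.AtomisticToContinuum.FouriersLaw.Theorems.SubdiffusiveBondHeat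

/-- **Mean of a bath heat along the stationary flow.** For the pinned chain (`ω₂ > 0`, `lam, β, γ ≥ 0`), a probability
measure `μ` invariant for the constructed kernels with all moments `(1 + H)^m ∈ L¹(μ)`, a site `i` and `t ≥ 0`:
`E_{μ⊗W}[p_i(t)²/2 - p_i(0)²/2 + ∫₀ᵗ p_i ∂_{q_i}H (z_s) ds] = t ∫ p_i ∂_{q_i}H dμ` (one-time laws + Fubini, helper 5).
[folklore] -/
theorem pinnedChain_integral_bathHeat_of_invariant {ω₂ lam β γ : ℝ} (hω : 0 < ω₂) (hl : 0 ≤ lam) (hβ : 0 ≤ β)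
    (hγ : 0 ≤ γ) (N : ℕ) (T_L T_R : ℝ) (μ : Measure (PhaseSpace N)) [IsProbabilityMeasure μ]
    (hinv : ∀ s : ℝ≥0, μ.bind ((pinnedChain ω₂ lam β γ).transitionKernel N T_L T_R s) = μ)
    (hmom : ∀ m : ℕ, Integrable (fun x => (1 + (pinnedChain ω₂ lam β γ).hamiltonian N x) ^ m) μ) (i : Fin N)
    {t : ℝ} (ht : 0 ≤ t) :
    ∫ p, (((pinnedChain ω₂ lam β γ).solMap N T_L T_R t p.1 (pairPath p.2)).2 i ^ 2 / 2 - p.1.2 i ^ 2 / 2 +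
        ∫ s in (0 : ℝ)..t, ((pinnedChain ω₂ lam β γ).solMap N T_L T_R s p.1 (pairPath p.2)).2 i *
          partialQ i ((pinnedChain ω₂ lam β γ).hamiltonian N)
            ((pinnedChain ω₂ lam β γ).solMap N T_L T_R s p.1 (pairPath p.2))) ∂(μ.prod wienerPair) =
      t * ∫ x, x.2 i * partialQ i ((pinnedChain ω₂ lam β γ).hamiltonian N) x ∂μ := by
  have hP := pinnedChain_isConfining hω hl hβ hγ
  obtain ⟨A, hA0, hA⟩ := hP.exists_abs_deriv_U_le
  obtain ⟨B, hB0, hB⟩ := hP.exists_abs_deriv_V_le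
  have hH1 : ContDiff ℝ 1 ((pinnedChain ω₂ lam β γ).hamiltonian N) := (hP.contDiff_hamiltonian N).of_le (by norm_num)
  -- the kinetic energy of site `i` and the work integrand
  have hk : Integrable (fun x : PhaseSpace N => x.2 i ^ 2 / 2) μ :=
    integrable_of_abs_le_pow hmom (by fun_prop) (abs_kinetic_le hP.U_nonneg hP.V_nonneg · i)
  have hgc : Continuous fun x : PhaseSpace N => x.2 i * partialQ i ((pinnedChain ω₂ lam β γ).hamiltonian N) x := by
    have hc : Continuous (partialQ i ((pinnedChain ω₂ lam β γ).hamiltonian N)) :=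
      (pinnedChain ω₂ lam β γ).continuous_partialQ_hamiltonian hH1 i
    fun_prop
  have hgi : Integrable (fun x : PhaseSpace N => x.2 i * partialQ i ((pinnedChain ω₂ lam β γ).hamiltonian N) x) μ :=
    integrable_momentum_mul_partialQ hP.U_nonneg hP.V_nonneg hmom hH1 hA0 hB0 hA hB hP.differentiable_U
      hP.differentiable_V i i
  have hg2 : Integrable (fun x : PhaseSpace N => (x.2 i * partialQ i ((pinnedChain ω₂ lam β γ).hamiltonian N) x) ^ 2) μ :=
    integrable_sq_of_abs_le_pow hmom hgc
      (abs_momentum_mul_partialQ_le hP.U_nonneg hP.V_nonneg hA0 hB0 hA hB hP.differentiable_U hP.differentiable_V · i i)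
  obtain ⟨hA, hAv⟩ := pinnedChain_integrable_comp_solMap_of_invariant hω hl hβ hγ N T_L T_R μ hinv hk t
  have hB : Integrable (fun p : PhaseSpace N × WienerPair => p.1.2 i ^ 2 / 2) (μ.prod wienerPair) := hk.comp_fst wienerPair
  have hBv : ∫ p, p.1.2 i ^ 2 / 2 ∂(μ.prod wienerPair) = ∫ x, x.2 i ^ 2 / 2 ∂μ :=
    integral_comp_fst_prod_wienerPair μ (fun x => x.2 i ^ 2 / 2)
  obtain ⟨hC, hCv⟩ := pinnedChain_timeIntegral_of_invariant hω hl hβ hγ N T_L T_R μ hinv hgc.measurable hgi hg2 ht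
  have hAB : Integrable (fun p : PhaseSpace N × WienerPair =>
      ((pinnedChain ω₂ lam β γ).solMap N T_L T_R t p.1 (pairPath p.2)).2 i ^ 2 / 2 - p.1.2 i ^ 2 / 2)
      (μ.prod wienerPair) := hA.sub hB
  rw [integral_add hAB hC, integral_sub hA hB, hAv, hBv, hCv]
  ring

/-- Steady heat rates for a weak steady state of the pinned chain under weak-NESS uniqueness: in the steady state the
mean heat absorbed from the left bath on `[0, t]`, minus the mean heat absorbed from the right bath, and the mean heat
through every real bond all equal `t · J` with `J = totalCurrent/(N-1)`, and `⟨p_0 ∂_{q_0}H⟩_μ = J`. Proof: see the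
module docstring (KB identification by uniqueness, weak stationarity on the elementary observables, one-time laws and
Fubini along the constructed flow). [folklore] -/
theorem stub_steadyHeatRates :
  ∀ ω₂ lam β γ : ℝ, 0 < ω₂ → 0 < lam → 0 < β → 0 < γ →
  (∀ (N : ℕ) (T_L T_R : ℝ), 0 < T_L → 0 < T_R → ∀ μ ν : Measure (PhaseSpace N),
    (pinnedChain ω₂ lam β γ).IsSteadyState N T_L T_R μ →
    (pinnedChain ω₂ lam β γ).IsSteadyState N T_L T_R ν → μ = ν) →
  ∀ (N : ℕ) (i0 iN ib : Fin N), 2 ≤ N → i0.val = 0 → iN.val = N - 1 → ib.val + 1 < N →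
  ∀ (T_L T_R : ℝ), 0 < T_L → 0 < T_R → ∀ μ : Measure (PhaseSpace N),
    (pinnedChain ω₂ lam β γ).IsSteadyState N T_L T_R μ →
  ∀ t : ℝ, 0 ≤ t →
    ∫ p, leftHeat i0 p ∂(fluxLaw (pinnedChain ω₂ lam β γ) N i0 iN ib T_L T_R t μ) =
      t * ((pinnedChain ω₂ lam β γ).totalCurrent μ / ((N : ℝ) - 1)) ∧
    ∫ p, rightHeat iN p ∂(fluxLaw (pinnedChain ω₂ lam β γ) N i0 iN ib T_L T_R t μ) =
      -(t * ((pinnedChain ω₂ lam β γ).totalCurrent μ / ((N : ℝ) - 1))) ∧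
    ∫ p, p.2.2.2.2 ∂(fluxLaw (pinnedChain ω₂ lam β γ) N i0 iN ib T_L T_R t μ) =
      t * ((pinnedChain ω₂ lam β γ).totalCurrent μ / ((N : ℝ) - 1)) ∧
    ∫ x, x.2 i0 * partialQ i0 ((pinnedChain ω₂ lam β γ).hamiltonian N) x ∂μ =
      (pinnedChain ω₂ lam β γ).totalCurrent μ / ((N : ℝ) - 1) := by
  intro ω₂ lam β γ hω hl hβ hγ huniq N i0 iN ib hN hi0 hiN hib T_L T_R hL hR μ hμ t ht
  -- Step 0: `μ` is the Krylov–Bogoliubov invariant measure of the constructed semigroup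
  have hN1 : 1 < N := by omega
  obtain ⟨ν, hνP, hinv, hint⟩ := pinnedChainSemigroup_exists_isInvariant_of_pos hω hl hβ hγ hN1 hL hR
  have hmax : 0 < max T_L T_R := lt_max_of_lt_left hL
  have hϑ0 : 0 < 1 / max T_L T_R / 2 := by positivity
  have hϑ1 : 1 / max T_L T_R / 2 < 1 / max T_L T_R := half_lt_self (by positivity)
  have hνss : (pinnedChain ω₂ lam β γ).IsSteadyState N T_L T_R ν :=
    pinnedChain_isSteadyState_of_isInvariant hω.le hl.le hβ.le γ N _ hinv hϑ0 (hint _ hϑ0 hϑ1)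
  have hμν : μ = ν := huniq N T_L T_R hL hR _ _ hμ hνss
  rw [hμν]
  have hinv' : ∀ u : ℝ≥0, ν.bind ((pinnedChain ω₂ lam β γ).transitionKernel N T_L T_R u) = ν := fun u => hinv u
  have hmom : ∀ m : ℕ, Integrable (fun x => (1 + (pinnedChain ω₂ lam β γ).hamiltonian N x) ^ m) ν :=
    pinnedChain_polynomialMoments ω₂ lam β γ hω.le hl.le hβ.le N ν _ hϑ0 (hint _ hϑ0 hϑ1)
  have hP := pinnedChain_isConfining hω hl.le hβ.le hγ.le
  -- Step 1: the steady currents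
  obtain ⟨hJb, htot, hWN⟩ := pinnedChain_steadyCurrents ω₂ lam β γ hω hl.le hβ.le hγ.le N i0 iN hN hi0 hiN T_L T_R
    hL.le hR.le ν hνss.2.1 hmom
  have hNr : (N : ℝ) - 1 ≠ 0 := by
    have : (2 : ℝ) ≤ N := by exact_mod_cast hN
    linarith
  have hJ : (pinnedChain ω₂ lam β γ).totalCurrent ν / ((N : ℝ) - 1) =
      ∫ x, x.2 i0 * partialQ i0 ((pinnedChain ω₂ lam β γ).hamiltonian N) x ∂ν := by
    rw [htot]; field_simp
  rw [hJ]
  -- Step 2: the flux law is the image of `ν ⊗ W` under a measurable map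
  have hXt := pinnedChain_measurable_solMap_pairPath hω hl.le hβ.le hγ.le N T_L T_R t
  have hcQ : ∀ i : Fin N, Continuous (partialQ i ((pinnedChain ω₂ lam β γ).hamiltonian N)) := fun i =>
    (pinnedChain ω₂ lam β γ).continuous_partialQ_hamiltonian ((hP.contDiff_hamiltonian N).of_le (by norm_num)) i
  have hgm : ∀ i : Fin N, Measurable fun x : PhaseSpace N =>
      x.2 i * partialQ i ((pinnedChain ω₂ lam β γ).hamiltonian N) x := by
    intro i
    have := hcQ i
    exact Continuous.measurable (by fun_prop)
  have hbm : Measurable ((pinnedChain ω₂ lam β γ).bondCurrent N ib) :=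
    (pinnedChain_continuous_bondCurrent ω₂ lam β γ N ib).measurable
  have hΦ : Measurable fun zw : PhaseSpace N × WienerPair =>
      rawObs (pinnedChain ω₂ lam β γ) N i0 iN ib t zw.1 (fwdPath (pinnedChain ω₂ lam β γ) N T_L T_R zw.1 zw.2) := by
    have h := measurable_fst.prodMk (hXt.prodMk
      ((pinnedChain_measurable_timeIntegral hω hl.le hβ.le hγ.le N T_L T_R (hgm i0) ht).prodMk
        ((pinnedChain_measurable_timeIntegral hω hl.le hβ.le hγ.le N T_L T_R (hgm iN) ht).prodMk
          (pinnedChain_measurable_timeIntegral hω hl.le hβ.le hγ.le N T_L T_R hbm ht))))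
    exact h
  have hmL : Measurable (leftHeat i0 : Obs N → ℝ) := by unfold leftHeat; fun_prop
  have hmR : Measurable (rightHeat iN : Obs N → ℝ) := by unfold rightHeat; fun_prop
  rw [fluxLaw_eq, integral_map hΦ.aemeasurable hmL.aestronglyMeasurable,
    integral_map hΦ.aemeasurable hmR.aestronglyMeasurable,
    integral_map hΦ.aemeasurable (by fun_prop : Measurable fun p : Obs N => p.2.2.2.2).aestronglyMeasurable]
  -- Step 3: the three path expectations
  have hbath := fun i : Fin N =>
    pinnedChain_integral_bathHeat_of_invariant hω hl.le hβ.le hγ.le N T_L T_R ν hinv' hmom i ht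
  have hbond : ∫ zw, (rawObs (pinnedChain ω₂ lam β γ) N i0 iN ib t zw.1
      (fwdPath (pinnedChain ω₂ lam β γ) N T_L T_R zw.1 zw.2)).2.2.2.2 ∂(ν.prod wienerPair) =
      t * ∫ x, (pinnedChain ω₂ lam β γ).bondCurrent N ib x ∂ν := by
    have hjb : ∀ x, |(pinnedChain ω₂ lam β γ).bondCurrent N ib x| ≤
        (N * ((3 + β) / 2)) * (1 + (pinnedChain ω₂ lam β γ).hamiltonian N x) ^ 2 := fun x =>
      (pinnedChain_abs_bondCurrent_le hω.le hl.le hβ.le γ N ib x).trans_eq (by ring)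
    have hji : Integrable ((pinnedChain ω₂ lam β γ).bondCurrent N ib) ν :=
      integrable_of_abs_le_pow hmom (pinnedChain_continuous_bondCurrent ω₂ lam β γ N ib) hjb
    have hj2 : Integrable (fun x => (pinnedChain ω₂ lam β γ).bondCurrent N ib x ^ 2) ν :=
      integrable_sq_of_abs_le_pow hmom (pinnedChain_continuous_bondCurrent ω₂ lam β γ N ib) hjb
    exact (pinnedChain_timeIntegral_of_invariant hω hl.le hβ.le hγ.le N T_L T_R ν hinv' hbm hji hj2 ht).2
  refine ⟨?_, ?_, ?_, rfl⟩
  · exact hbath i0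
  · rw [show -(t * ∫ x, x.2 i0 * partialQ i0 ((pinnedChain ω₂ lam β γ).hamiltonian N) x ∂ν) =
        t * ∫ x, x.2 iN * partialQ iN ((pinnedChain ω₂ lam β γ).hamiltonian N) x ∂ν by rw [hWN]; ring]
    exact hbath iN
  · rw [hbond, hJb ib hib]

end Summit.AtomisticToContinuum.FouriersLaw.Theorems.LinearResponseFTUR

end
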